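import Literature.Computability.Complexity.FlatPrograms
import Literature.Computability.Complexity.HaltGuard
import HarnessLib

/-!
# Flat runs of guarded machines: completeness AND soundness of the flat simulation

Fourth stage of the tree's efficient universal machine (Arora–Barak 2009, §1.4, Thm. 1.9), after
`PolyTimeCountable.lean` (bundled `TM2` machine ↦ standard machine, `TM2Std.outputs_tr`),
`FlatPrograms.lean` (standard machine ↦ flat program, `FlatProg.runsB_step`) and
`UniversalStep.lean` (the flat step as ONE polynomial-time string function). Those files prove the
FORWARD simulation; a clocked universal ACCEPTANCE test (`ClockedUniversalAcceptance.lean`) also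
needs the converse — "the flat run sits at the code of the halting configuration with output `y`
⟹ the machine outputs `y`" — which meets two obstacles: (a) `TM2Std.outputs_tr` and
`FlatProg.exists_iterate_of_iterate` are one-way; (b) the flat code of a halted configuration
(`FlatProg.trCfg`, program counter `haltAddr`) forgets the internal state, whereas Mathlib's
`Turing.TM2OutputsInTime` demands halting in `initialState`. This file supplies the converses and
removes (b) by simulating, instead of `M`, its HALTING GUARD `HaltGuard.guardAux M`
(`HaltGuard.lean`: same outputs within the same time, and it halts only in its initial state):

* `TM2Std.outputsInTime_of_std` — **converse of `TM2Std.outputs_tr`**: if the standard machine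
  outputs the code of `L'` on the code of `L` within `m` steps then the machine outputs `L'` on `L`
  within `m` steps (codes of allowed symbols are injective, `TM2Std.eq_of_trCfg_eq`; a dead run is
  matched by a dead run, `TM2Std.iterate_tr_none`); `TM2Std.std_var_of_halted` — the standard
  machine of a PROPER machine (one halting only in its initial state) is proper along runs from
  coded initial configurations;
* `FlatProg.exists_iterate_le_of_iterate` — `n` machine steps take `≤ n · haltAddr` flat steps
  (the counted form of `FlatProg.exists_iterate_of_iterate`, from `FlatProg.runsB_step`);
  `FlatProg.exists_halt_of_iterate` — **soundness of flat runs**: if after `M` flat steps the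
  program counter is at the halt address, the standard machine has halted within `M` steps in a
  configuration whose code is the flat configuration reached;
* `FlatProg.ucode M = TM2Std.stdCode (HaltGuard.guardAux M).tm`, `FlatProg.initCfg M x`,
  `FlatProg.haltCfg M y` (the flat initial/halting configurations, spelled out in
  `initCfg_eq`/`haltCfg_eq`), and the two-way interface
  **`FlatProg.flat_complete`**: `M.OutputsWithin x y t → t · haltAddr ≤ m →
  (step (compile (ucode M)))^[m] (initCfg M x) = haltCfg M y`, and
  **`FlatProg.flat_sound`**: `(step (compile (ucode M)))^[m] (initCfg M x) = haltCfg M y →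
  M.OutputsWithin x y m`.

## References

* S. Arora, B. Barak, *Computational Complexity: A Modern Approach*, CUP 2009, §1.4 (machines as
  strings), Thm. 1.9 and §1.4.1 (universal TM with time bound) [AroraBarakCC2009].
* Mathlib, `Mathlib/Computability/TuringMachine/Computable.lean` (`Turing.TM2OutputsInTime`,
  `Turing.haltList`).
-/

noncomputable section

namespace Literature.Computability.Complexity

/-! ### Standard machines: the converse of `TM2Std.outputs_tr` -/

namespace TM2Std

open Turing Function

variable (tm : FinTM2)

/-- Codes of allowed symbols determine the symbol. [folklore] -/
theorem eq_of_enc_eq {x y : Σ k, tm.Γ k} (hx : x ∈ allowed tm) (h : enc tm x = enc tm y) : x = y := by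
  by_cases hy : y ∈ allowed tm
  · have h1 := dec_enc tm hx
    rw [h, dec_enc tm hy] at h1
    exact (Option.some.inj h1).symm
  · exfalso
    unfold enc at h
    rw [dif_pos hx, dif_neg hy] at h
    exact Fin.succ_ne_zero _ h

/-- Coding a stack of allowed symbols is injective. [folklore] -/
theorem eq_of_stkCode_eq {k : tm.K} : ∀ {L₁ L₂ : List (tm.Γ k)},
    (∀ γ ∈ L₁, (⟨k, γ⟩ : Σ k, tm.Γ k) ∈ allowed tm) → stkCode tm k L₁ = stkCode tm k L₂ → L₁ = L₂
  | [], [], _, _ => rfl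
  | [], _ :: _, _, h => by simp [stkCode] at h
  | _ :: _, [], _, h => by simp [stkCode] at h
  | γ₁ :: L₁, γ₂ :: L₂, hL, h => by
    simp only [stkCode, List.map_cons, List.cons.injEq] at h
    have h1 : γ₁ = γ₂ := by
      have := eq_of_enc_eq tm (hL γ₁ (by simp)) h.1
      exact eq_of_heq (Sigma.mk.inj this).2
    subst h1
    rw [eq_of_stkCode_eq (fun γ hγ => hL γ (by simp [hγ])) h.2]

/-- Coding configurations with allowed symbols only is injective. [folklore] -/
theorem eq_of_trCfg_eq {c d : tm.Cfg} (hc : StkOK tm c.stk) (h : trCfg tm c = trCfg tm d) : c = d := by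
  obtain ⟨l, v, S⟩ := c
  obtain ⟨l', v', S'⟩ := d
  have hl : l.map (eΛ tm) = l'.map (eΛ tm) := congrArg TM2.Cfg.l h
  have hv : eσ tm v = eσ tm v' := congrArg TM2.Cfg.var h
  have hS : trStk tm S = trStk tm S' := congrArg TM2.Cfg.stk h
  have h1 : l = l' := Option.map_injective (eΛ tm).injective hl
  have h2 : v = v' := (eσ tm).injective hv
  have h3 : S = S' := by
    funext k
    have := congrFun hS (eK tm k)
    rw [trStk_apply, trStk_apply] at this
    exact eq_of_stkCode_eq tm (hc k) this
  subst h1 h2 h3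
  rfl

/-- The standard machine halts on the codes of halted configurations. [folklore] -/
theorem std_step_trCfg_none {c : tm.Cfg} (h : tm.step c = none) : (stdCode tm).tm.step (trCfg tm c) = none := by
  obtain ⟨_ | l, v, S⟩ := c
  · rfl
  · exact absurd h (by simp [FinTM2.step, TM2.step])

/-- A run of the machine that has died is matched by a dead run of the standard machine.
[folklore] -/
theorem iterate_tr_none (n : ℕ) : ∀ c : tm.Cfg, StkOK tm c.stk →
    (flip bind tm.step)^[n] (some c) = none →
      (flip bind (stdCode tm).tm.step)^[n] (some (trCfg tm c)) = none := by
  induction n with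
  | zero => intro c _ h; simp at h
  | succ n ih =>
    intro c hc h
    rw [TM2Comp.iterate_bind_succ] at h ⊢
    cases hfc : tm.step c with
    | none => rw [std_step_trCfg_none tm hfc, TM2Comp.iterate_bind_none]
    | some c' =>
      rw [hfc] at h
      obtain ⟨h1, h2⟩ := step_tr tm c c' hc hfc
      rw [h1]
      exact ih c' h2 h

/-- **A run of the standard machine from a coded initial configuration is the code of a run of
the machine.** [cite: AroraBarak2009, §1.4] -/
theorem exists_of_iterate_std {L : List (tm.Γ tm.k₀)} {n : ℕ} {D : (stdCode tm).tm.Cfg}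
    (h : (flip bind (stdCode tm).tm.step)^[n] (some (initList (stdCode tm).tm (stkCode tm tm.k₀ L))) = some D) :
    ∃ C : tm.Cfg, (flip bind tm.step)^[n] (some (initList tm L)) = some C ∧ StkOK tm C.stk ∧ D = trCfg tm C := by
  rw [← trCfg_initList] at h
  have hinit := stkOK_initList tm L
  cases hr : (flip bind tm.step)^[n] (some (initList tm L)) with
  | none =>
    rw [iterate_tr_none tm n _ hinit hr] at h
    cases h
  | some C =>
    obtain ⟨h1, h2⟩ := iterate_tr tm n _ C hinit hr
    rw [h1] at h
    exact ⟨C, rfl, h2, (Option.some.inj h).symm⟩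

/-- **Outputs correspond, converse of `outputs_tr`**: if the standard machine outputs the code of
`L'` on the code of `L` within `m` steps, then the machine outputs `L'` on `L` within `m` steps.
[cite: AroraBarak2009, §1.4] -/
theorem outputsInTime_of_std {L : List (tm.Γ tm.k₀)} {L' : List (tm.Γ tm.k₁)} {m : ℕ}
    (h : Nonempty (TM2OutputsInTime (stdCode tm).tm (stkCode tm tm.k₀ L) (some (stkCode tm tm.k₁ L')) m)) :
    Nonempty (TM2OutputsInTime tm L (some L') m) := by
  obtain ⟨⟨⟨n, hev⟩, hle⟩⟩ := h
  simp only [Option.map_some] at hev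
  obtain ⟨C, hC, hok, hD⟩ := exists_of_iterate_std tm hev
  rw [← trCfg_haltList] at hD
  have hC' : C = haltList tm L' := eq_of_trCfg_eq tm hok hD.symm
  subst hC'
  exact ⟨⟨⟨n, by simpa using hC⟩, hle⟩⟩

/-- The last configuration of a run of positive length is the result of a step. [folklore] -/
theorem exists_step_of_iterate_succ {σ' : Type} (f : σ' → Option σ') {a d : σ'} {n : ℕ}
    (h : (flip bind f)^[n + 1] (some a) = some d) : ∃ x, (flip bind f)^[n] (some a) = some x ∧ f x = some d := by
  rw [iterate_succ_apply'] at h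
  cases hx : (flip bind f)^[n] (some a) with
  | none => rw [hx] at h; cases h
  | some x => rw [hx] at h; exact ⟨x, rfl, h⟩

/-- **Proper machines have proper standard machines**: if `tm` halts only in its initial state,
then every halted configuration that the standard machine reaches from a coded initial
configuration is in ITS initial state. [folklore] -/
theorem std_var_of_halted
    (hprop : ∀ X Y : tm.Cfg, tm.step X = some Y → Y.l = none → Y.var = tm.initialState)
    {L : List (tm.Γ tm.k₀)} {n : ℕ} {D : (stdCode tm).tm.Cfg}
    (h : (flip bind (stdCode tm).tm.step)^[n] (some (initList (stdCode tm).tm (stkCode tm tm.k₀ L))) = some D)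
    (hD : D.l = none) : D.var = (stdCode tm).init := by
  obtain ⟨C, hC, -, rfl⟩ := exists_of_iterate_std tm h
  obtain ⟨Cl, Cv, CS⟩ := C
  have hCl : Cl = none := by
    cases Cl with
    | none => rfl
    | some l => exact absurd hD (by simp [trCfg])
  subst hCl
  cases n with
  | zero =>
    have h0 : initList tm L = ⟨none, Cv, CS⟩ := Option.some.inj hC
    rw [TM2Comp.initList_eq] at h0
    cases h0
  | succ n =>
    obtain ⟨X, -, hX⟩ := exists_step_of_iterate_succ tm.step hC
    have hv := hprop X _ hX rfl
    show eσ tm Cv = eσ tm tm.initialState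
    exact congrArg (eσ tm) hv

end TM2Std

/-! ### Flat programs: runs with step counts, both ways -/

namespace FlatProg

open Turing TM2Std Function
open UnivTM2 (encStk)

variable (c : SCode)

/-- **Runs, completeness with a step count**: `n` steps of the standard machine are matched by at
most `n · haltAddr c` steps of its flat program. [cite: AroraBarakCC2009, §1.4] -/
theorem exists_iterate_le_of_iterate (n : ℕ) : ∀ {a b : c.tm.Cfg},
    (flip bind c.tm.step)^[n] (some a) = some b →
      ∃ m ≤ n * haltAddr c, (step (compile c))^[m] (trCfg c a) = trCfg c b := by
  induction n with
  | zero =>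
    intro a b h
    simp only [iterate_zero, id_eq, Option.some.injEq] at h
    subst h
    exact ⟨0, Nat.zero_le _, rfl⟩
  | succ n ih =>
    intro a b h
    rw [TM2Comp.iterate_bind_succ] at h
    cases ha : c.tm.step a with
    | none => rw [ha, TM2Comp.iterate_bind_none] at h; cases h
    | some a' =>
      rw [ha] at h
      obtain ⟨m₁, -, hm₁, e₁, -⟩ := runsB_step c ha
      obtain ⟨m₂, hm₂, e₂⟩ := ih h
      refine ⟨m₂ + m₁, by rw [Nat.succ_mul]; omega, ?_⟩
      rw [iterate_add_apply, e₁, e₂]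

/-- **Runs, soundness with a step count**: if after `M` flat steps from the code of `a` the
program counter is at (or beyond) the halt address, then the standard machine halts from `a`
within `M` steps, in a configuration whose code is the flat configuration reached.
[cite: AroraBarakCC2009, §1.4] -/
theorem exists_halt_of_iterate : ∀ (M : ℕ) (a : c.tm.Cfg),
    haltAddr c ≤ ((step (compile c))^[M] (trCfg c a)).1 →
      ∃ n ≤ M, ∃ d : c.tm.Cfg, (flip bind c.tm.step)^[n] (some a) = some d ∧ c.tm.step d = none ∧
        (step (compile c))^[M] (trCfg c a) = trCfg c d := by
  intro M
  induction M using Nat.strong_induction_on with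
  | _ M ih =>
    intro a hM
    cases ha : c.tm.step a with
    | none =>
      refine ⟨0, Nat.zero_le _, a, rfl, ha, ?_⟩
      exact iterate_step_of_le
        (by rw [length_compile, trCfg_fst_of_none c ((step_eq_none_iff c a).1 ha)]) M
    | some a' =>
      obtain ⟨m, hm1, -, hstep, hpc⟩ := runsB_step c ha
      rcases lt_or_ge M m with hlt | hge
      · exact absurd hM (not_le.2 (by rw [← length_compile]; exact hpc M hlt))
      · obtain ⟨r, rfl⟩ := Nat.exists_eq_add_of_le hge
        rw [Nat.add_comm, iterate_add_apply, hstep] at hM ⊢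
        obtain ⟨n, hn, d, hrun, hd, hfin⟩ := ih r (by omega) a' hM
        refine ⟨n + 1, by omega, d, ?_, hd, hfin⟩
        rw [TM2Comp.iterate_bind_succ, ha]
        exact hrun

/-- `encStk` is injective. [folklore] -/
theorem encStk_injective {nK N : ℕ} : Function.Injective (encStk (nK := nK) (N := N)) := by
  intro S S' h
  funext k
  have := congrFun (List.ofFn_injective h) k
  exact List.map_injective_iff.2 Fin.val_injective this

/-! ### Machines: the flat code of the guarded standard machine -/

variable {Γ₀ Γ₁ : Type}

/-- **The standard code simulated by the universal machine for `M`**: the standard machine of the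
halting guard of `M`. [cite: AroraBarakCC2009, §1.4] -/
abbrev ucode (M : TM2ComputableAux Γ₀ Γ₁) : SCode := stdCode (HaltGuard.guardAux M).tm

/-- The coded input word of `M`. [folklore] -/
def inCode (M : TM2ComputableAux Γ₀ Γ₁) (x : List Γ₀) : List (Fin ((ucode M).N + 1)) :=
  stkCode (HaltGuard.guardAux M).tm (HaltGuard.guardAux M).tm.k₀ (x.map M.inputAlphabet.symm)

/-- The coded output word of `M`. [folklore] -/
def outCode (M : TM2ComputableAux Γ₀ Γ₁) (y : List Γ₁) : List (Fin ((ucode M).N + 1)) :=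
  stkCode (HaltGuard.guardAux M).tm (HaltGuard.guardAux M).tm.k₁ (y.map M.outputAlphabet.symm)

/-- The flat initial configuration of `M` on `x`. [folklore] -/
def initCfg (M : TM2ComputableAux Γ₀ Γ₁) (x : List Γ₀) : Cfg :=
  trCfg (ucode M) (initList (ucode M).tm (inCode M x))

/-- The flat halting configuration of `M` with output `y`. [folklore] -/
def haltCfg (M : TM2ComputableAux Γ₀ Γ₁) (y : List Γ₁) : Cfg :=
  trCfg (ucode M) (haltList (ucode M).tm (outCode M y))

/-- The flat initial configuration, spelled out. [folklore] -/
theorem initCfg_eq (M : TM2ComputableAux Γ₀ Γ₁) (x : List Γ₀) :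
    initCfg M x = (entry (ucode M) (ucode M).main (ucode M).init,
      (List.replicate (ucode M).nK []).set (ucode M).k₀ ((inCode M x).map Fin.val)) := by
  rw [initCfg, TM2Comp.initList_eq]
  show (entry (ucode M) (ucode M).main (ucode M).init, encStk _) = _
  rw [UnivTM2.encStk_update, UnivTM2.encStk_empty]

/-- The flat halting configuration, spelled out. [folklore] -/
theorem haltCfg_eq (M : TM2ComputableAux Γ₀ Γ₁) (y : List Γ₁) :
    haltCfg M y = (haltAddr (ucode M),
      (List.replicate (ucode M).nK []).set (ucode M).k₁ ((outCode M y).map Fin.val)) := by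
  rw [haltCfg, TM2Comp.haltList_eq]
  show (haltAddr (ucode M), encStk _) = _
  rw [UnivTM2.encStk_update, UnivTM2.encStk_empty]

/-- The program counter of the flat halting configuration is the halt address. [folklore] -/
theorem haltCfg_fst (M : TM2ComputableAux Γ₀ Γ₁) (y : List Γ₁) : (haltCfg M y).1 = haltAddr (ucode M) :=
  trCfg_fst_of_none _ (by rw [TM2Comp.haltList_eq])

/-- **Completeness of the flat simulation**: if `M` outputs `y` on `x` within `t` steps, then for
every `m ≥ t · haltAddr` the flat program of `ucode M`, run `m` steps from the flat initial
configuration on `x`, sits at the flat halting configuration with output `y`.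
[cite: AroraBarakCC2009, §1.4 and Thm. 1.9] -/
theorem flat_complete (M : TM2ComputableAux Γ₀ Γ₁) {x : List Γ₀} {y : List Γ₁} {t m : ℕ}
    (h : M.OutputsWithin x y t) (hm : t * haltAddr (ucode M) ≤ m) :
    (step (compile (ucode M)))^[m] (initCfg M x) = haltCfg M y := by
  have hG : (HaltGuard.guardAux M).OutputsWithin x y t := (HaltGuard.outputsWithin_guardAux_iff M).2 h
  obtain ⟨⟨⟨n, hev⟩, hle⟩⟩ := (outputs_tr (HaltGuard.guardAux M).tm hG).1
  simp only [Option.map_some] at hev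
  obtain ⟨m₀, hm₀, hrun⟩ := exists_iterate_le_of_iterate (ucode M) n hev
  have hle' : m₀ ≤ m := hm₀.trans ((Nat.mul_le_mul_right _ hle).trans hm)
  obtain ⟨d, rfl⟩ := Nat.exists_eq_add_of_le hle'
  rw [Nat.add_comm, iterate_add_apply]
  have hrun' : (step (compile (ucode M)))^[m₀] (initCfg M x) = haltCfg M y := hrun
  rw [hrun']
  exact iterate_step_of_le (by rw [length_compile, haltCfg_fst]) d

/-- **Soundness of the flat simulation**: if the flat program of `ucode M`, run `m` steps from the
flat initial configuration on `x`, sits at the flat halting configuration with output `y`, then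
`M` outputs `y` on `x` within `m` steps. (Uses the halting guard: the standard machine of
`guardAux M` halts only in its initial state, so the flat halting configuration — which forgets
the state — does come from `haltList`.) [cite: AroraBarakCC2009, §1.4 and Thm. 1.9] -/
theorem flat_sound (M : TM2ComputableAux Γ₀ Γ₁) {x : List Γ₀} {y : List Γ₁} {m : ℕ}
    (h : (step (compile (ucode M)))^[m] (initCfg M x) = haltCfg M y) : M.OutputsWithin x y m := by
  have hpc : haltAddr (ucode M) ≤ ((step (compile (ucode M)))^[m] (initCfg M x)).1 := by
    rw [h, haltCfg_fst]
  obtain ⟨n, hn, d, hrun, hd, hfin⟩ := exists_halt_of_iterate (ucode M) m _ hpc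
  have hfin' : haltCfg M y = trCfg (ucode M) d := h.symm.trans hfin
  -- `d` is the halting configuration of the standard machine
  have hdl : d.l = none := (step_eq_none_iff _ d).1 hd
  have hdv : d.var = (ucode M).init :=
    std_var_of_halted (HaltGuard.guardAux M).tm (fun X Y => HaltGuard.guardAux_proper M) hrun hdl
  have hds : (haltList (ucode M).tm (outCode M y)).stk = d.stk := by
    have := congrArg Prod.snd hfin'
    rw [haltCfg, trCfg_snd, trCfg_snd] at this
    exact encStk_injective this
  have hdeq : d = haltList (ucode M).tm (outCode M y) := by
    obtain ⟨dl, dv, ds⟩ := d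
    simp only at hdl hdv hds
    subst hdl hdv
    rw [TM2Comp.haltList_eq] at hds ⊢
    simp only at hds
    rw [hds]
  subst hdeq
  have hstd : Nonempty (TM2OutputsInTime (ucode M).tm (inCode M x) (some (outCode M y)) m) :=
    ⟨⟨⟨n, by simpa using hrun⟩, hn⟩⟩
  exact (HaltGuard.outputsWithin_guardAux_iff M).1 (outputsInTime_of_std (HaltGuard.guardAux M).tm hstd)

end FlatProg

end Literature.Computability.Complexity
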